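import Summits.Parity.GeneralizedHardyLittlewood.Theorems.LeeYangFibresAbsoluteUpgradeModGammaDefs
import Summits.Parity.GeneralizedHardyLittlewood.Theorems.LeeYangFibresModelHyperbolicityCalculus
import Summits.Parity.GeneralizedHardyLittlewood.Theorems.LeeYangFibresModelCellFactsDensityBounds
import HarnessLib

/-!
# `ModGammaDisc` from the adjoint method — auxiliary pieces (crux stmt-Parity-14116, line `dip-margin-rate-exchange`, lead seat c1)

Declaration-sized pieces of the assembly `modGammaDisc_of_adjoint`
(file `LeeYangFibresAbsoluteUpgradeModGammaAssembly.lean`): the finite-interval continuous induction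
(`continuousInduction_Icc`, Greaves' Lemma 4.2.9 on `[s₁ − 1, T]`) and its packaged form `apriori_bound`
(the registered helper of this file), the crude row bound `rowFn_norm_le`, a bound for `1/Γ` on a disc, the ratio
bound `t^x (t+1)^{-x} ≤ 2^{K+1}`, the two-sided comparison from a relative error, and the *window step* /
*final division* (pure norm algebra on the invariant `K·G + z·I = 1/Γ`).
-/

noncomputable section

namespace Summit.Parity.GeneralizedHardyLittlewood.Cruxes.AbsoluteUpgrade.DipMarginRateExchange

open scoped BigOperators
open MeasureTheory Set Filter
open scoped Interval
open Summit.Parity.GeneralizedHardyLittlewood.Cruxes.ModelHyperbolicity.WindowChainTransport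
  (cellDensity modelEval stub_calculus calc_nonneg)


/-! ## Finite-interval continuous induction -/

/-- **Continuous induction on `[s₁ − 1, T]`** (Greaves 2001, Lemma 4.2.9, finite-interval form): if `u` is
continuous on `[s₁ − 1, T]`, bounded by `A > 1` on `[s₁ − 1, s₁]`, and `u(s) < 1/2 + K/2` for every
`s ∈ [s₁, T]` and every upper bound `K` of `u` on `[s − 1, s]`, then `u ≤ A` on `[s₁ − 1, T]`.
[cite: Greaves2001, Lemma 4.2.9] -/
theorem continuousInduction_Icc {u : ℝ → ℝ} {s₁ T A : ℝ} (hA : 1 < A)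
    (hu : ContinuousOn u (Icc (s₁ - 1) T)) (h0 : ∀ x ∈ Icc (s₁ - 1) s₁, u x ≤ A)
    (hstep : ∀ s, s₁ ≤ s → s ≤ T → ∀ K : ℝ, (∀ x ∈ Icc (s - 1) s, u x ≤ K) → u s < 1 / 2 + K / 2) :
    ∀ s, s₁ - 1 ≤ s → s ≤ T → u s ≤ A := by
  by_contra hneg
  simp only [not_forall, not_le, exists_prop] at hneg
  obtain ⟨t₀, ht₀, ht₀T, ht₀A⟩ := hneg
  set Tb : Set ℝ := {t | s₁ ≤ t ∧ t ≤ T ∧ A < u t} with hTb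
  have ht₀Tb : t₀ ∈ Tb := by
    refine ⟨?_, ht₀T, ht₀A⟩
    by_contra hlt
    exact absurd (h0 t₀ ⟨ht₀, (not_le.mp hlt).le⟩) (not_le.mpr ht₀A)
  have hne : Tb.Nonempty := ⟨t₀, ht₀Tb⟩
  have hbdd : BddBelow Tb := ⟨s₁, fun t ht => ht.1⟩
  set c : ℝ := sInf Tb with hc
  have hc₁ : s₁ ≤ c := le_csInf hne fun t ht => ht.1
  have hcle : ∀ t ∈ Tb, c ≤ t := fun t ht => csInf_le hbdd ht
  have hcT : c ≤ T := (hcle t₀ ht₀Tb).trans ht₀T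
  -- `u ≤ A` strictly to the left of `c` (within `[s₁ - 1, T]`)
  have hleft : ∀ y, s₁ - 1 ≤ y → y < c → u y ≤ A := by
    intro y hy hyc
    by_cases hy₁ : y ≤ s₁
    · exact h0 y ⟨hy, hy₁⟩
    · by_contra hAy
      exact absurd (hcle y ⟨(not_le.mp hy₁).le, (hyc.le.trans hcT), not_le.mp hAy⟩) (not_le.mpr hyc)
  have hcS : c ∈ Icc (s₁ - 1) T := ⟨by linarith, hcT⟩
  have hcont := Metric.continuousWithinAt_iff.mp (hu c hcS)
  -- `u c ≤ A`
  have hucle : u c ≤ A := by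
    by_contra hAc
    rw [not_le] at hAc
    rcases hc₁.eq_or_lt with h | h
    · rw [← h] at hAc
      exact absurd (h0 s₁ ⟨by linarith, le_rfl⟩) (not_le.mpr hAc)
    · obtain ⟨δ, hδ, hδu⟩ := hcont (u c - A) (by linarith)
      set y : ℝ := max s₁ (c - δ / 2) with hy
      have hy₁ : s₁ ≤ y := le_max_left _ _
      have hyc : y < c := max_lt h (by linarith)
      have hyδ : dist y c < δ := by
        rw [Real.dist_eq, abs_of_neg (by linarith)]
        have : c - δ / 2 ≤ y := le_max_right _ _
        linarith
      have hclose := hδu (show y ∈ Icc (s₁ - 1) T from ⟨by linarith, hyc.le.trans hcT⟩) hyδ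
      rw [Real.dist_eq] at hclose
      have hAy : A < u y := by
        have := (abs_lt.mp hclose).1
        linarith
      exact absurd (hcle y ⟨hy₁, hyc.le.trans hcT, hAy⟩) (not_le.mpr hyc)
  -- `A ≤ u c`
  have hAuc : A ≤ u c := by
    by_contra hcA
    rw [not_le] at hcA
    obtain ⟨δ, hδ, hδu⟩ := hcont (A - u c) (by linarith)
    obtain ⟨t, htT, htδ⟩ := exists_lt_of_csInf_lt hne (show c < c + δ by linarith)
    have hct : c ≤ t := hcle t htT
    have hdist : dist t c < δ := by
      rw [Real.dist_eq, abs_of_nonneg (by linarith)]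
      linarith
    have hclose := hδu (show t ∈ Icc (s₁ - 1) T from ⟨by linarith [htT.1], htT.2.1⟩) hdist
    rw [Real.dist_eq] at hclose
    have := (abs_lt.mp hclose).2
    linarith [htT.2.2]
  have hK : ∀ x ∈ Icc (c - 1) c, u x ≤ A := by
    intro x hx
    rcases hx.2.eq_or_lt with h | h
    · rw [h]; exact hucle
    · exact hleft x (by linarith [hx.1]) h
  have := hstep c hc₁ hcT A hK
  linarith

/-! ## Crude bounds on the row -/

/-- **Crude bound on the row**: `|K_z(t)| = |Σ_{j<u} I_{j+1}(t+1) z^j| ≤ (t+1)^{|z|}` for `t ≥ 0`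
(`I_{j+1}(τ) ≤ (log τ)^j/j!`, tree `cellDensity_le_pow_div_factorial`, and `Σ_j x^j/j! ≤ e^x`). -/
theorem rowFn_norm_le (u : ℕ) (z : ℂ) {t : ℝ} (ht : 0 ≤ t) : ‖rowFn u z t‖ ≤ (t + 1) ^ ‖z‖ := by
  have ht1 : (1 : ℝ) ≤ t + 1 := by linarith
  have hlog : 0 ≤ Real.log (t + 1) := Real.log_nonneg ht1
  unfold rowFn modelEval
  calc ‖∑ j ∈ Finset.range u, (cellDensity j (t + 1) : ℂ) * z ^ j‖
      ≤ ∑ j ∈ Finset.range u, ‖(cellDensity j (t + 1) : ℂ) * z ^ j‖ := norm_sum_le _ _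
    _ ≤ ∑ j ∈ Finset.range u, (‖z‖ * Real.log (t + 1)) ^ j / j.factorial := by
        refine Finset.sum_le_sum fun j _ => ?_
        rw [norm_mul, norm_pow, Complex.norm_real, Real.norm_of_nonneg (calc_nonneg j _)]
        have h1 := Summit.Parity.GeneralizedHardyLittlewood.Theorems.ModelCellFacts.cellDensity_le_pow_div_factorial
          j (t + 1) ht1
        calc cellDensity j (t + 1) * ‖z‖ ^ j ≤ Real.log (t + 1) ^ j / j.factorial * ‖z‖ ^ j :=
              mul_le_mul_of_nonneg_right h1 (pow_nonneg (norm_nonneg _) _)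
          _ = (‖z‖ * Real.log (t + 1)) ^ j / j.factorial := by rw [mul_pow]; ring
    _ ≤ Real.exp (‖z‖ * Real.log (t + 1)) := Real.sum_le_exp_of_nonneg (by positivity) _
    _ = (t + 1) ^ ‖z‖ := by
        rw [Real.rpow_def_of_pos (by linarith), mul_comm]

/-! ## The assembly: abstract pieces

The proof of `modGammaDisc_of_adjoint` is split into small declaration-sized pieces (each elaborates well
within the default heartbeat budget): a bound for `1/Γ` on a disc, the ratio bound `t^x (t+1)^{-x} ≤ 2^{K+1}`,
the two-sided comparison from a relative error, the *window step* and the *final division* (pure norm algebra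
on the invariant `K·G + z·I = 1/Γ`), and the a-priori bound (continuous induction, packaged). -/

/-- `1/Γ(1+z)` is bounded on every closed disc `‖z‖ ≤ R` (it is entire). -/
theorem norm_GammaInv_le_of_norm_le (R : ℝ) (hR : 0 ≤ R) :
    ∃ C : ℝ, 0 ≤ C ∧ ∀ z : ℂ, ‖z‖ ≤ R → ‖(Complex.Gamma (1 + z))⁻¹‖ ≤ C := by
  have hc : Continuous fun z : ℂ => (Complex.Gamma (1 + z))⁻¹ :=
    Complex.differentiable_one_div_Gamma.continuous.comp (continuous_const.add continuous_id)
  obtain ⟨C, hC⟩ := (isCompact_closedBall (0 : ℂ) R).exists_bound_of_continuousOn hc.continuousOn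
  exact ⟨C, le_trans (norm_nonneg _) (hC 0 (by simp [hR])),
    fun z hz => hC z (mem_closedBall_zero_iff.mpr hz)⟩

/-- The ratio bound `t^x (t+1)^{-x} ≤ 2^{K+1}` for `t ≥ 1` and `-(K+1) ≤ x`. -/
theorem rpow_mul_rpow_neg_succ_le (K : ℕ) {x t : ℝ} (hx : -((K : ℝ) + 1) ≤ x) (ht : 1 ≤ t) :
    t ^ x * (t + 1) ^ (-x) ≤ 2 ^ (K + 1) := by
  have ht0 : 0 < t := by linarith
  have ht10 : 0 < t + 1 := by linarith
  rw [Real.rpow_neg ht10.le, ← div_eq_mul_inv, ← Real.div_rpow ht0.le ht10.le]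
  by_cases hx0 : 0 ≤ x
  · calc (t / (t + 1)) ^ x ≤ 1 :=
          Real.rpow_le_one (by positivity) ((div_le_one ht10).mpr (by linarith)) hx0
      _ ≤ 2 ^ (K + 1) := one_le_pow₀ (by norm_num)
  · push Not at hx0
    have h1 : (t / (t + 1)) ^ x = ((t + 1) / t) ^ (-x) := by
      rw [Real.rpow_neg (by positivity), ← Real.inv_rpow (by positivity), inv_div]
    rw [h1]
    have h2 : (t + 1) / t ≤ 2 := by
      rw [div_le_iff₀ ht0]; linarith
    calc ((t + 1) / t) ^ (-x) ≤ (2 : ℝ) ^ (-x) :=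
          Real.rpow_le_rpow (by positivity) h2 (by linarith)
      _ ≤ (2 : ℝ) ^ ((K : ℝ) + 1) := Real.rpow_le_rpow_of_exponent_le (by norm_num) (by linarith)
      _ = 2 ^ (K + 1) := by norm_cast

/-- Two-sided comparison `½‖E‖ ≤ ‖G‖ ≤ 2‖E‖` from a relative error `‖G − E‖ ≤ c‖E‖` with `c ≤ ½`. -/
theorem norm_bounds_of_rel_err {G E : ℂ} {c : ℝ} (h : ‖G - E‖ ≤ c * ‖E‖) (hc : c ≤ 1 / 2) :
    ‖E‖ / 2 ≤ ‖G‖ ∧ ‖G‖ ≤ 2 * ‖E‖ := by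
  have hc' : ‖G - E‖ ≤ ‖E‖ / 2 := by
    calc ‖G - E‖ ≤ c * ‖E‖ := h
      _ ≤ 1 / 2 * ‖E‖ := by gcongr
      _ = ‖E‖ / 2 := by ring
  constructor
  · have := norm_sub_norm_le E G
    rw [norm_sub_rev] at this
    linarith
  · have := norm_le_insert' G E
    linarith [norm_nonneg E]

/-- **Window step** (norm algebra): from the invariant `K·G + z·I = Γi` with `‖Γi‖ ≤ CΓ`, `‖I‖ ≤ B`,
`‖z‖ ≤ R`, `½‖E‖ ≤ ‖G‖` and `‖E‖ = e^{a} w^{-x}`, the normalised size `‖K‖ w^{-x}` is at most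
`(2CΓ + 2RB) e^{-a}`. -/
theorem window_div {Kw G Γi I z E : ℂ} {w x a CΓ R B : ℝ}
    (hinv : Kw * G + z * I = Γi) (hΓ : ‖Γi‖ ≤ CΓ) (hI : ‖I‖ ≤ B) (hz : ‖z‖ ≤ R)
    (hlow : ‖E‖ / 2 ≤ ‖G‖) (hE : ‖E‖ = Real.exp a * w ^ (-x)) :
    ‖Kw‖ * w ^ (-x) ≤ (2 * CΓ + 2 * R * B) * Real.exp (-a) := by
  have hR0 : 0 ≤ R := (norm_nonneg z).trans hz
  have hKG : ‖Kw‖ * ‖G‖ ≤ CΓ + R * B := by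
    rw [← norm_mul, show Kw * G = Γi - z * I by rw [← hinv]; ring]
    calc ‖Γi - z * I‖ ≤ ‖Γi‖ + ‖z * I‖ := norm_sub_le _ _
      _ = ‖Γi‖ + ‖z‖ * ‖I‖ := by rw [norm_mul]
      _ ≤ CΓ + R * B := add_le_add hΓ (mul_le_mul hz hI (norm_nonneg _) hR0)
  have h2 : ‖Kw‖ * (Real.exp a * w ^ (-x)) ≤ 2 * (CΓ + R * B) := by
    calc ‖Kw‖ * (Real.exp a * w ^ (-x)) = 2 * (‖Kw‖ * (‖E‖ / 2)) := by rw [hE]; ring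
      _ ≤ 2 * (‖Kw‖ * ‖G‖) := by gcongr
      _ ≤ 2 * (CΓ + R * B) := by linarith
  have hexp : 0 < Real.exp a := Real.exp_pos a
  calc ‖Kw‖ * w ^ (-x) = ‖Kw‖ * (Real.exp a * w ^ (-x)) * Real.exp (-a) := by
        rw [Real.exp_neg]; field_simp
    _ ≤ 2 * (CΓ + R * B) * Real.exp (-a) := by gcongr
    _ = (2 * CΓ + 2 * R * B) * Real.exp (-a) := by ring

/-- **Final division** (norm algebra): from the invariant `K·G + z·I = Γi` with `‖Γi‖ ≤ CΓ`, `‖I‖ ≤ B`,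
`‖z‖ ≤ R`, the Watson error `‖G − E‖ ≤ (C₁/v)‖E‖`, `½‖E‖ ≤ ‖G‖` and `‖E‖ = e^{a} v^{-x}`:
`‖K − Γi E⁻¹‖ ≤ (2CΓC₁/v + 2RB) e^{-a} v^{x}`. -/
theorem final_div {Kv G Γi I z E : ℂ} {v x a CΓ C₁ R B : ℝ} (hv : 0 < v)
    (hinv : Kv * G + z * I = Γi) (hΓ : ‖Γi‖ ≤ CΓ) (hI : ‖I‖ ≤ B) (hz : ‖z‖ ≤ R)
    (hEG : ‖G - E‖ ≤ C₁ / v * ‖E‖) (hlow : ‖E‖ / 2 ≤ ‖G‖)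
    (hE : ‖E‖ = Real.exp a * v ^ (-x)) :
    ‖Kv - Γi * E⁻¹‖ ≤ (2 * CΓ * C₁ / v + 2 * R * B) * (Real.exp (-a) * v ^ x) := by
  have hR0 : 0 ≤ R := (norm_nonneg z).trans hz
  have hB0 : 0 ≤ B := (norm_nonneg I).trans hI
  have hCΓ0 : 0 ≤ CΓ := (norm_nonneg Γi).trans hΓ
  have hEpos : 0 < ‖E‖ := by rw [hE]; positivity
  have hGpos : 0 < ‖G‖ := lt_of_lt_of_le (by linarith) hlow
  have hG0 : G ≠ 0 := norm_pos_iff.mp hGpos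
  have hE0 : E ≠ 0 := norm_pos_iff.mp hEpos
  have hC₁0 : 0 ≤ C₁ / v * ‖E‖ := (norm_nonneg _).trans hEG
  have hKv : Kv = (Γi - z * I) / G := by rw [eq_div_iff hG0, ← hinv]; ring
  have hdiff : Kv - Γi * E⁻¹ = Γi * ((E - G) / (G * E)) - z * I / G := by
    rw [hKv]; field_simp; ring
  have hEinv : ‖E‖⁻¹ = Real.exp (-a) * v ^ x := by
    rw [hE, mul_inv, Real.exp_neg, Real.rpow_neg hv.le, inv_inv]
  have h1 : ‖Γi * ((E - G) / (G * E))‖ ≤ 2 * CΓ * C₁ / v * (Real.exp (-a) * v ^ x) := by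
    rw [norm_mul, norm_div, norm_mul]
    have hden : ‖E‖ / 2 * ‖E‖ ≤ ‖G‖ * ‖E‖ := by gcongr
    have hEG' : ‖E - G‖ ≤ C₁ / v * ‖E‖ := by rw [norm_sub_rev]; exact hEG
    calc ‖Γi‖ * (‖E - G‖ / (‖G‖ * ‖E‖))
        ≤ CΓ * (C₁ / v * ‖E‖ / (‖E‖ / 2 * ‖E‖)) := by
          apply mul_le_mul hΓ _ (by positivity) hCΓ0
          calc ‖E - G‖ / (‖G‖ * ‖E‖) ≤ ‖E - G‖ / (‖E‖ / 2 * ‖E‖) :=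
                div_le_div_of_nonneg_left (norm_nonneg _) (by positivity) hden
            _ ≤ C₁ / v * ‖E‖ / (‖E‖ / 2 * ‖E‖) := by gcongr
      _ = 2 * CΓ * C₁ / v * ‖E‖⁻¹ := by field_simp
      _ = 2 * CΓ * C₁ / v * (Real.exp (-a) * v ^ x) := by rw [hEinv]
  have h2 : ‖z * I / G‖ ≤ 2 * R * B * (Real.exp (-a) * v ^ x) := by
    rw [norm_div, norm_mul]
    calc ‖z‖ * ‖I‖ / ‖G‖ ≤ R * B / (‖E‖ / 2) :=
          div_le_div₀ (by positivity) (mul_le_mul hz hI (norm_nonneg _) hR0) (by positivity) hlow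
      _ = 2 * R * B * ‖E‖⁻¹ := by field_simp
      _ = 2 * R * B * (Real.exp (-a) * v ^ x) := by rw [hEinv]
  rw [hdiff]
  calc ‖Γi * ((E - G) / (G * E)) - z * I / G‖
      ≤ ‖Γi * ((E - G) / (G * E))‖ + ‖z * I / G‖ := norm_sub_le _ _
    _ ≤ 2 * CΓ * C₁ / v * (Real.exp (-a) * v ^ x) + 2 * R * B * (Real.exp (-a) * v ^ x) :=
        add_le_add h1 h2
    _ = (2 * CΓ * C₁ / v + 2 * R * B) * (Real.exp (-a) * v ^ x) := by ring

/-- **A-priori bound** (continuous induction, packaged): a continuous nonnegative `M` on `[v₁−1, v]`,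
bounded by `B₀` on the initial window `[v₁−1, v₁]` and satisfying the contracting window estimate
`M(w) ≤ A₁ + S/2` whenever `M ≤ S` on `[w−1, w]` (`v₁ ≤ w ≤ v`), is bounded by
`max (B₀/(2A₁+1) + 1) 2 · (2A₁+1)` on the whole of `[v₁−1, v]`. -/
theorem apriori_bound : ∀ {M : ℝ → ℝ} {v₁ v A₁ B₀ : ℝ}, 0 ≤ A₁ → ContinuousOn M (Set.Icc (v₁ - 1) v) → (∀ t ∈ Set.Icc (v₁ - 1) v, 0 ≤ M t) → (∀ t ∈ Set.Icc (v₁ - 1) v₁, M t ≤ B₀) → (∀ w, v₁ ≤ w → w ≤ v → ∀ S, 0 ≤ S → (∀ t ∈ Set.Icc (w - 1) w, M t ≤ S) → M w ≤ A₁ + S / 2) → ∀ t ∈ Set.Icc (v₁ - 1) v, M t ≤ max (B₀ / (2 * A₁ + 1) + 1) 2 * (2 * A₁ + 1) := by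
  intro M v₁ v A₁ B₀ hA₁ hcont hM0 h0 hstep
  set L : ℝ := 2 * A₁ + 1 with hL
  have hL0 : 0 < L := by positivity
  set Astar : ℝ := max (B₀ / L + 1) 2 with hAstar
  have hAstar1 : 1 < Astar := lt_of_lt_of_le (by norm_num) (le_max_right _ _)
  set uf : ℝ → ℝ := fun t => M t / L with huf
  have hufcont : ContinuousOn uf (Icc (v₁ - 1) v) := hcont.div_const L
  have h0' : ∀ x ∈ Icc (v₁ - 1) v₁, uf x ≤ Astar := by
    intro x hx
    simp only [huf]
    rw [div_le_iff₀ hL0]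
    calc M x ≤ B₀ := h0 x hx
      _ = B₀ / L * L := by field_simp
      _ ≤ (B₀ / L + 1) * L := by nlinarith
      _ ≤ Astar * L := by gcongr; exact le_max_left _ _
  have hstep' : ∀ s, v₁ ≤ s → s ≤ v → ∀ K' : ℝ, (∀ x ∈ Icc (s - 1) s, uf x ≤ K') →
      uf s < 1 / 2 + K' / 2 := by
    intro s hs hsv K' hK'
    have hsmem : s ∈ Icc (s - 1) s := ⟨by linarith, le_rfl⟩
    have hK'0 : 0 ≤ K' := by
      have h1 := hK' s hsmem
      have h2 : 0 ≤ uf s := div_nonneg (hM0 s ⟨by linarith, hsv⟩) hL0.le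
      linarith
    have hS : ∀ t ∈ Icc (s - 1) s, M t ≤ K' * L := by
      intro t ht
      have := hK' t ht
      simp only [huf] at this
      rwa [div_le_iff₀ hL0] at this
    have hMs := hstep s hs hsv (K' * L) (by positivity) hS
    simp only [huf]
    rw [div_lt_iff₀ hL0]
    have hA₁L : A₁ < L / 2 := by rw [hL]; linarith
    calc M s ≤ A₁ + K' * L / 2 := hMs
      _ < L / 2 + K' * L / 2 := by linarith
      _ = (1 / 2 + K' / 2) * L := by ring
  have hap := continuousInduction_Icc hAstar1 hufcont h0' hstep'
  intro t ht
  have := hap t ht.1 ht.2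
  simp only [huf] at this
  rwa [div_le_iff₀ hL0] at this

/-- Watson's error in relative form: from `d ≤ (Ca/w)·P`, `P ≥ 0` and `1 ≤ X·e`,
`d ≤ (max Ca 0 · X / w)·(e·P)`. -/
theorem watson_relerr {d Ca w P e X : ℝ} (hw : 0 < w) (hP : 0 ≤ P) (h : d ≤ Ca / w * P)
    (hee : 1 ≤ X * e) : d ≤ max Ca 0 * X / w * (e * P) := by
  have h1 : d ≤ max Ca 0 / w * P := h.trans (by gcongr; exact le_max_left _ _)
  have h2 : 0 ≤ max Ca 0 / w * P := by positivity
  calc d ≤ max Ca 0 / w * P := h1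
    _ = max Ca 0 / w * P * 1 := by ring
    _ ≤ max Ca 0 / w * P * (X * e) := by gcongr
    _ = max Ca 0 * X / w * (e * P) := by ring

/-- Pointwise bound for the window integrand `|K(t)| |g(t+1)|` from `|K(t)| = M(t) t^{x}`, `M(t) ≤ S`,
`|g(t+1)| ≤ 2e(t+1)^{-x}/(t+1)`, the ratio bound `t^x (t+1)^{-x} ≤ P` and `w ≤ t + 1`. -/
theorem integrand_bound {nK ng Mt S a b e P w t : ℝ} (hnK : nK = Mt * a) (hMt : Mt ≤ S)
    (ha : 0 ≤ a) (hng : ng ≤ 2 * e * b / (t + 1)) (hng0 : 0 ≤ ng) (hab : a * b ≤ P)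
    (he : 0 ≤ e) (hS : 0 ≤ S) (hw : 0 < w) (ht : 0 < t + 1) (hwt : w ≤ t + 1) (hP : 0 ≤ P) :
    nK * ng ≤ S * (2 * e * P) / w := by
  rw [hnK]
  have h1 : Mt * a * ng ≤ S * a * ng := by gcongr
  have h2 : S * a * ng ≤ S * a * (2 * e * b / (t + 1)) := by gcongr
  calc Mt * a * ng ≤ S * a * (2 * e * b / (t + 1)) := h1.trans h2
    _ = S * (2 * e) * (a * b) / (t + 1) := by ring
    _ ≤ S * (2 * e) * P / (t + 1) := by gcongr
    _ ≤ S * (2 * e) * P / w := by gcongr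
    _ = S * (2 * e * P) / w := by ring

/-- **Window step**, specialised: with `‖I‖ ≤ S(2e^{a}P)/w` and `e^{-a} ≤ X`,
`‖K‖ w^{-x} ≤ 2CΓ X + (2(2RP)/w) S`. -/
theorem window_step {Kw G Γi I z E : ℂ} {w x a CΓ R S P X : ℝ}
    (hinv : Kw * G + z * I = Γi) (hΓ : ‖Γi‖ ≤ CΓ) (hI : ‖I‖ ≤ S * (2 * Real.exp a * P) / w)
    (hz : ‖z‖ ≤ R) (hlow : ‖E‖ / 2 ≤ ‖G‖) (hE : ‖E‖ = Real.exp a * w ^ (-x))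
    (hX : Real.exp (-a) ≤ X) (hCΓ : 0 ≤ CΓ) :
    ‖Kw‖ * w ^ (-x) ≤ 2 * CΓ * X + 2 * (2 * R * P) / w * S := by
  have h := window_div hinv hΓ hI hz hlow hE
  calc ‖Kw‖ * w ^ (-x) ≤ _ := h
    _ = 2 * CΓ * Real.exp (-a) + 2 * (2 * R * P) / w * S * (Real.exp a * Real.exp (-a)) := by ring
    _ = 2 * CΓ * Real.exp (-a) + 2 * (2 * R * P) / w * S := by
          rw [← Real.exp_add, add_neg_cancel, Real.exp_zero, mul_one]
    _ ≤ 2 * CΓ * X + 2 * (2 * R * P) / w * S := by gcongr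

/-- **Final division**, specialised: with `‖I‖ ≤ A(2e^{a}P)/v` and `e^{-a} ≤ X`,
`‖K − Γi E⁻¹‖ ≤ (2CΓC₁X + 2(2RP)A)·v^{x}/v`. -/
theorem final_step {Kv G Γi I z E : ℂ} {v x a CΓ C₁ R A P X : ℝ} (hv : 0 < v)
    (hinv : Kv * G + z * I = Γi) (hΓ : ‖Γi‖ ≤ CΓ) (hI : ‖I‖ ≤ A * (2 * Real.exp a * P) / v)
    (hz : ‖z‖ ≤ R) (hEG : ‖G - E‖ ≤ C₁ / v * ‖E‖) (hlow : ‖E‖ / 2 ≤ ‖G‖)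
    (hE : ‖E‖ = Real.exp a * v ^ (-x)) (hX : Real.exp (-a) ≤ X) (hCΓ : 0 ≤ CΓ) (hC₁ : 0 ≤ C₁) :
    ‖Kv - Γi * E⁻¹‖ ≤ (2 * CΓ * C₁ * X + 2 * (2 * R * P) * A) * (v ^ x / v) := by
  have h := final_div hv hinv hΓ hI hz hEG hlow hE
  have hvx : 0 ≤ v ^ x / v := by positivity
  calc ‖Kv - Γi * E⁻¹‖ ≤ _ := h
    _ = (2 * CΓ * C₁ * Real.exp (-a) + 2 * (2 * R * P) * A * (Real.exp a * Real.exp (-a))) *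
          (v ^ x / v) := by ring
    _ = (2 * CΓ * C₁ * Real.exp (-a) + 2 * (2 * R * P) * A) * (v ^ x / v) := by
        rw [← Real.exp_add, add_neg_cancel, Real.exp_zero, mul_one]
    _ ≤ (2 * CΓ * C₁ * X + 2 * (2 * R * P) * A) * (v ^ x / v) := by gcongr

end Summit.Parity.GeneralizedHardyLittlewood.Cruxes.AbsoluteUpgrade.DipMarginRateExchange

end
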